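import Summits.KontsevichZagierPeriods.KontsevichZagierPeriods.Theses.IsogenyCertificates
import Summits.KontsevichZagierPeriods.KontsevichZagierPeriods.Theorems.XMapPeriodTransfer.Negative.LoadBearingDatum

/-!
# `XMapPeriodTransfer` (stmt-KontsevichZagierPeriods-10665), line `saturated-sign-cells` —
stub `stub_cellMonotone` (E1: cell structure and monotonicity of the x-map)

For an x-rational isogeny datum `(f, g, c)` between `y² = P(x) = x³ + Ax + B` and
`y² = P'(x) = x³ + A'x + B'` (Wronskian `W = f'g − fg' ≠ 0`, certificate identity
`c²·g·(f³ + A'fg² + B'g³) = P·W²`), on every CELL, i.e. every connected component `K` of the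
cell locus `L = {P > 0, W ≠ 0} ⊆ ℝ`:

* the x-map `R = f/g` has no pole (`g ≠ 0`: evaluate the identity),
* `P'(R) = P·W²/(c²g⁴) > 0`,
* `R' = W/g²` (quotient rule), of constant sign on `K` (IVT), so `R` is strictly (anti)monotone,
* `K = (p, ∞)` or `K = (p, q)` with `P·W = 0` at the finite ends (an open connected subset of
  `ℝ`, bounded below since `P < 0` far left; ends are not in the open set `L` but in the closure
  of `{P > 0}`).

All of this is elementary real analysis over Mathlib.

References: M. Kontsevich, D. Zagier, *Periods* (2001), §1.2 (rule (2), change of variables);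
L. C. Washington, *Elliptic Curves* (2008), §2.9.
-/

noncomputable section

open Set Filter MeasureTheory Polynomial Topology
open Literature.NumberTheory.Transcendental

namespace Summit.KontsevichZagierPeriods.IsogenyCertificates.XMapPeriodTransferCells

/-! ### Pointwise consequences of the certificate identity -/

/-- No pole on the cell locus: if `P(x) > 0` and `W(x) ≠ 0` then `g(x) ≠ 0` (evaluate the
certificate identity at `x`: the left side would vanish, the right side is `P(x)·W(x)² ≠ 0`).
[folklore] -/
theorem cellMonotone_noPole {A B A' B' : ℤ} {f g : ℚ[X]} {c : ℚ}
    (hI : C (c ^ 2) * g * (f ^ 3 + C (A' : ℚ) * f * g ^ 2 + C (B' : ℚ) * g ^ 3) =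
      (X ^ 3 + C (A : ℚ) * X + C (B : ℚ)) * (derivative f * g - f * derivative g) ^ 2)
    {x : ℝ} (hP : 0 < x ^ 3 + (A : ℝ) * x + (B : ℝ))
    (hW : aeval x (derivative f * g - f * derivative g) ≠ 0) : aeval x g ≠ 0 := by
  intro hg
  have hid := congrArg (fun p : ℚ[X] => aeval x p) hI
  simp only [map_mul, map_add, map_pow, aeval_C, aeval_X, hg, eq_ratCast, Rat.cast_intCast,
    mul_zero, zero_mul] at hid
  have hx : (x ^ 3 + (A : ℝ) * x + B) *
      (aeval x (derivative f * g - f * derivative g)) ^ 2 ≠ 0 := by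
    have := pow_ne_zero 2 hW
    positivity
  exact hx hid.symm

/-- Positivity of the target cubic along the x-map: `P'(R(x)) = P(x)·W(x)²/(c²·g(x)⁴) > 0` on
the cell locus. [folklore] -/
theorem cellMonotone_targetPos {A B A' B' : ℤ} {f g : ℚ[X]} {c : ℚ} (hc : c ≠ 0)
    (hI : C (c ^ 2) * g * (f ^ 3 + C (A' : ℚ) * f * g ^ 2 + C (B' : ℚ) * g ^ 3) =
      (X ^ 3 + C (A : ℚ) * X + C (B : ℚ)) * (derivative f * g - f * derivative g) ^ 2)
    {x : ℝ} (hP : 0 < x ^ 3 + (A : ℝ) * x + (B : ℝ))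
    (hW : aeval x (derivative f * g - f * derivative g) ≠ 0) (hg : aeval x g ≠ 0) :
    0 < (aeval x f / aeval x g) ^ 3 + (A' : ℝ) * (aeval x f / aeval x g) + (B' : ℝ) := by
  have hid := congrArg (fun p : ℚ[X] => aeval x p) hI
  simp only [map_mul, map_add, map_pow, aeval_C, aeval_X, eq_ratCast, Rat.cast_intCast] at hid
  have hc' : (c : ℝ) ≠ 0 := by exact_mod_cast hc
  have hpos : 0 < (x ^ 3 + (A : ℝ) * x + B) *
      (aeval x (derivative f * g - f * derivative g)) ^ 2 := by
    have := pow_ne_zero 2 hW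
    positivity
  have key : (aeval x f / aeval x g) ^ 3 + (A' : ℝ) * (aeval x f / aeval x g) + (B' : ℝ) =
      (x ^ 3 + (A : ℝ) * x + B) * (aeval x (derivative f * g - f * derivative g)) ^ 2 /
        ((c : ℝ) ^ 2 * (aeval x g) ^ 4) := by
    rw [← hid]
    field_simp
  rw [key]
  positivity

/-- Quotient rule for the x-map: `R' = (f'g − fg')/g² = W/g²` wherever `g ≠ 0`. [folklore] -/
theorem cellMonotone_hasDerivAt (f g : ℚ[X]) {x : ℝ} (hg : aeval x g ≠ 0) :
    HasDerivAt (fun y : ℝ => aeval y f / aeval y g)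
      (aeval x (derivative f * g - f * derivative g) / (aeval x g) ^ 2) x := by
  have e : aeval x (derivative f * g - f * derivative g) =
      aeval x (derivative f) * aeval x g - aeval x f * aeval x (derivative g) := by
    simp only [map_sub, map_mul]
  rw [e]
  exact (Polynomial.hasDerivAt_aeval f x).div (Polynomial.hasDerivAt_aeval g x) hg

/-! ### Open connected subsets of `ℝ` bounded below -/

/-- The connected component of a point `x₀` of an open subset `S ⊆ ℝ` bounded below is an open
interval `(p, ∞)` or `(p, q)` whose finite ends are not in `S`, with `p < x₀ < q`. [folklore] -/
theorem cellMonotone_component_shape {S : Set ℝ} (hS : IsOpen S) {m x₀ : ℝ}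
    (hm : ∀ y ∈ S, m ≤ y) (hx₀ : x₀ ∈ S) :
    ∃ p : ℝ, p < x₀ ∧ p ∉ S ∧ (connectedComponentIn S x₀ = Ioi p ∨
      ∃ q : ℝ, x₀ < q ∧ q ∉ S ∧ connectedComponentIn S x₀ = Ioo p q) := by
  set K := connectedComponentIn S x₀ with hK
  have hKo : IsOpen K := hS.connectedComponentIn
  have hKS : K ⊆ S := connectedComponentIn_subset _ _
  have hx₀K : x₀ ∈ K := mem_connectedComponentIn hx₀
  have hKne : K.Nonempty := ⟨x₀, hx₀K⟩
  have hKbdd : BddBelow K := ⟨m, fun y hy => hm y (hKS hy)⟩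
  have hKoc : OrdConnected K :=
    isPreconnected_iff_ordConnected.mp isPreconnected_connectedComponentIn
  -- a closed interval inside `S` meeting `K` lies in `K`
  have hIccK : ∀ {a b y : ℝ}, Icc a b ⊆ S → y ∈ Icc a b → y ∈ K → Icc a b ⊆ K :=
    fun hab hy hyK => by
    have h := isPreconnected_Icc.subset_connectedComponentIn hy hab
    rwa [← connectedComponentIn_eq hyK] at h
  -- an open set contains small open balls
  have hball : ∀ {T : Set ℝ} {z : ℝ}, IsOpen T → z ∈ T →
      ∃ ε > 0, Ioo (z - ε) (z + ε) ⊆ T := by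
    intro T z hT hz
    obtain ⟨ε, hε, h⟩ := Metric.isOpen_iff.mp hT z hz
    exact ⟨ε, hε, by rwa [Real.ball_eq_Ioo] at h⟩
  -- the infimum `p`
  set p := sInf K with hp
  have hpK : ∀ y ∈ K, p ≤ y := fun y hy => csInf_le hKbdd hy
  have hp_not : p ∉ K := by
    intro hpK'
    obtain ⟨ε, hε, hsub⟩ := hball hKo hpK'
    have hmem : p - ε / 2 ∈ K := hsub ⟨by linarith, by linarith⟩
    linarith [hpK _ hmem]
  have hlt_of_mem : ∀ y ∈ K, p < y := fun y hy =>
    lt_of_le_of_ne (hpK y hy) (fun h => hp_not (h ▸ hy))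
  have hpS : p ∉ S := by
    intro hpS'
    obtain ⟨ε, hε, hsub⟩ := hball hS hpS'
    obtain ⟨y, hyK, hyε⟩ := exists_lt_of_csInf_lt hKne (lt_add_of_pos_right p hε)
    have hIcc : Icc p y ⊆ S := fun z hz => hsub ⟨by linarith [hz.1], by linarith [hz.2]⟩
    exact hp_not (hIccK hIcc ⟨hpK y hyK, le_rfl⟩ hyK ⟨le_rfl, hpK y hyK⟩)
  refine ⟨p, hlt_of_mem x₀ hx₀K, hpS, ?_⟩
  by_cases hKa : BddAbove K
  · -- bounded cell `(p, q)`
    right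
    set q := sSup K with hq
    have hqK : ∀ y ∈ K, y ≤ q := fun y hy => le_csSup hKa hy
    have hq_not : q ∉ K := by
      intro hqK'
      obtain ⟨ε, hε, hsub⟩ := hball hKo hqK'
      have hmem : q + ε / 2 ∈ K := hsub ⟨by linarith, by linarith⟩
      linarith [hqK _ hmem]
    have hlt_of_mem' : ∀ y ∈ K, y < q := fun y hy =>
      lt_of_le_of_ne (hqK y hy) (fun h => hq_not (h ▸ hy))
    have hqS : q ∉ S := by
      intro hqS'
      obtain ⟨ε, hε, hsub⟩ := hball hS hqS'
      obtain ⟨y, hyK, hyε⟩ := exists_lt_of_lt_csSup hKne (sub_lt_self q hε)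
      have hIcc : Icc y q ⊆ S := fun z hz => hsub ⟨by linarith [hz.1], by linarith [hz.2]⟩
      exact hq_not (hIccK hIcc ⟨le_rfl, hqK y hyK⟩ hyK ⟨hqK y hyK, le_rfl⟩)
    refine ⟨q, hlt_of_mem' x₀ hx₀K, hqS, ?_⟩
    ext y
    refine ⟨fun hy => ⟨hlt_of_mem y hy, hlt_of_mem' y hy⟩, fun hy => ?_⟩
    obtain ⟨c₁, hc₁K, hc₁y⟩ := exists_lt_of_csInf_lt hKne hy.1
    obtain ⟨c₂, hc₂K, hyc₂⟩ := exists_lt_of_lt_csSup hKne hy.2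
    exact hKoc.out hc₁K hc₂K ⟨hc₁y.le, hyc₂.le⟩
  · -- unbounded cell `(p, ∞)`
    left
    ext y
    refine ⟨fun hy => hlt_of_mem y hy, fun hy => ?_⟩
    obtain ⟨c₁, hc₁K, hc₁y⟩ := exists_lt_of_csInf_lt hKne hy
    obtain ⟨c₂, hc₂K, hyc₂⟩ := not_bddAbove_iff.mp hKa y
    exact hKoc.out hc₁K hc₂K ⟨hc₁y.le, hyc₂.le⟩

/-! ### The stub -/

/-- `P ≤ 0` far to the left: the cell locus is bounded below by `-(1 + |A| + |B|)`. [folklore] -/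
theorem cellMonotone_lowerBound (A B : ℤ) {y : ℝ} (hy : 0 < y ^ 3 + (A : ℝ) * y + (B : ℝ)) :
    -(1 + |(A : ℝ)| + |(B : ℝ)|) ≤ y := by
  -- adapted from `cubic_pos_of_large_le` (…XMapPeriodTransferCellsBasic), with `y = -z`
  refine not_lt.mp fun h => ?_
  have hA : -|(A : ℝ)| ≤ (A : ℝ) := neg_abs_le _
  have hB : (B : ℝ) ≤ |(B : ℝ)| := le_abs_self _
  have h0A : 0 ≤ |(A : ℝ)| := abs_nonneg _
  have h0B : 0 ≤ |(B : ℝ)| := abs_nonneg _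
  obtain ⟨z, rfl⟩ : ∃ z : ℝ, y = -z := ⟨-y, (neg_neg y).symm⟩
  have hz : 1 + |(A : ℝ)| + |(B : ℝ)| ≤ z := by linarith
  have hz1 : 1 ≤ z := by linarith
  have hz0 : 0 ≤ z := by linarith
  nlinarith [mul_le_mul_of_nonneg_left hA hz0, sq_nonneg z, mul_le_mul_of_nonneg_left hz1 hz0,
    mul_le_mul_of_nonneg_left hz hz0, mul_nonneg hz0 h0B]

/-- At a finite end `z ∉ L` of a cell lying in the closure of the cell, `P(z)·W(z) = 0`.
[folklore] -/
theorem cellMonotone_end_eq_zero (A B : ℤ) (f g : ℚ[X]) {K : Set ℝ} {z : ℝ}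
    (hK : K ⊆ {y : ℝ | 0 < y ^ 3 + (A : ℝ) * y + (B : ℝ) ∧
      aeval y (derivative f * g - f * derivative g) ≠ 0})
    (hz : z ∉ {y : ℝ | 0 < y ^ 3 + (A : ℝ) * y + (B : ℝ) ∧
      aeval y (derivative f * g - f * derivative g) ≠ 0})
    (hzK : z ∈ closure K) :
    (z ^ 3 + (A : ℝ) * z + (B : ℝ)) * aeval z (derivative f * g - f * derivative g) = 0 := by
  have hP0 : 0 ≤ z ^ 3 + (A : ℝ) * z + (B : ℝ) := by
    have hsub : K ⊆ {y : ℝ | (fun _ => (0 : ℝ)) y < y ^ 3 + (A : ℝ) * y + (B : ℝ)} :=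
      fun y hy => (hK hy).1
    have h := (closure_mono hsub).trans (closure_lt_subset_le continuous_const (by fun_prop)) hzK
    exact h
  simp only [mem_setOf_eq, not_and, not_not] at hz
  rcases hP0.lt_or_eq with h | h
  · rw [hz h, mul_zero]
  · rw [← h, zero_mul]

/-- **Registered stub `stub_cellMonotone`** (E1, cell structure and monotonicity). On a cell `C`
(the connected component of `x₀` in the cell locus `L`): `g ≠ 0`, `P'(R) > 0`, `R` is
differentiable with `R' = W/g²`, `R` is strictly monotone or antitone on `C`, and `C = (p, ∞)` or
`C = (p, q)` with `P·W = 0` at the finite ends. [cite: KontsevichZagier2001, §1.2] -/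
theorem stub_cellMonotone : ∀ (A B A' B' : ℤ) (f g : ℚ[X]) (c : ℚ),
    derivative f * g - f * derivative g ≠ 0 →
    C (c ^ 2) * g * (f ^ 3 + C (A' : ℚ) * f * g ^ 2 + C (B' : ℚ) * g ^ 3) =
      (X ^ 3 + C (A : ℚ) * X + C (B : ℚ)) * (derivative f * g - f * derivative g) ^ 2 →
    ∀ (R W : ℝ → ℝ) (L : Set ℝ), R = (fun y => aeval y f / aeval y g) →
      W = (fun y => aeval y (derivative f * g - f * derivative g)) →
      L = {y : ℝ | 0 < y ^ 3 + (A : ℝ) * y + (B : ℝ) ∧ W y ≠ 0} →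
    ∀ x₀ ∈ L,
      (∀ x ∈ connectedComponentIn L x₀,
          aeval x g ≠ 0 ∧ 0 < R x ^ 3 + (A' : ℝ) * R x + (B' : ℝ) ∧
          HasDerivAt R (W x / (aeval x g) ^ 2) x) ∧
      (StrictMonoOn R (connectedComponentIn L x₀) ∨ StrictAntiOn R (connectedComponentIn L x₀)) ∧
      ∃ p : ℝ, p < x₀ ∧ (p ^ 3 + (A : ℝ) * p + (B : ℝ)) * W p = 0 ∧
        (connectedComponentIn L x₀ = Ioi p ∨
          ∃ q : ℝ, x₀ < q ∧ (q ^ 3 + (A : ℝ) * q + (B : ℝ)) * W q = 0 ∧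
            connectedComponentIn L x₀ = Ioo p q) := by
  intro A B A' B' f g c hWne hI R W L hR hW hL x₀ hx₀
  obtain ⟨-, hc⟩ := XMapPeriodTransferDatum.g_ne_zero_and_c_ne_zero hWne hI
  subst hR hW hL
  set L := {y : ℝ | 0 < y ^ 3 + (A : ℝ) * y + (B : ℝ) ∧
    (fun y : ℝ => aeval y (derivative f * g - f * derivative g)) y ≠ 0} with hL
  set K := connectedComponentIn L x₀ with hK
  have hPcont : Continuous fun y : ℝ => y ^ 3 + (A : ℝ) * y + (B : ℝ) := by fun_prop
  have hWcont : Continuous fun y : ℝ => aeval y (derivative f * g - f * derivative g) :=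
    Polynomial.continuous_aeval _
  have hLo : IsOpen L :=
    (isOpen_lt continuous_const hPcont).and (isOpen_ne_fun hWcont continuous_const)
  have hKL : K ⊆ L := connectedComponentIn_subset _ _
  have hx₀K : x₀ ∈ K := mem_connectedComponentIn hx₀
  -- (1) local facts on the cell
  have hloc : ∀ x ∈ K, aeval x g ≠ 0 ∧
      0 < (aeval x f / aeval x g) ^ 3 + (A' : ℝ) * (aeval x f / aeval x g) + (B' : ℝ) ∧
      HasDerivAt (fun y : ℝ => aeval y f / aeval y g)
        (aeval x (derivative f * g - f * derivative g) / (aeval x g) ^ 2) x := by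
    intro x hx
    have hg : aeval x g ≠ 0 := cellMonotone_noPole hI (hKL hx).1 (hKL hx).2
    exact ⟨hg, cellMonotone_targetPos hc hI (hKL hx).1 (hKL hx).2 hg,
      cellMonotone_hasDerivAt f g hg⟩
  refine ⟨hloc, ?_, ?_⟩
  · -- (2) strict (anti)monotonicity: `R' = W/g²` has the constant sign of `W` on `K`
    have hKpre : IsPreconnected K := isPreconnected_connectedComponentIn
    have hconv : Convex ℝ K := (Real.convex_iff_isPreconnected).mpr hKpre
    have hRcont : ContinuousOn (fun y : ℝ => aeval y f / aeval y g) K := fun x hx =>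
      (hloc x hx).2.2.continuousAt.continuousWithinAt
    have hint : interior K = K := (hLo.connectedComponentIn).interior_eq
    have hW₀ : aeval x₀ (derivative f * g - f * derivative g) ≠ 0 := hx₀.2
    rcases lt_or_gt_of_ne hW₀ with h0 | h0
    · right
      refine strictAntiOn_of_deriv_neg hconv hRcont fun x hx => ?_
      rw [hint] at hx
      rw [(hloc x hx).2.2.deriv]
      have hg := (hloc x hx).1
      have hWx : aeval x (derivative f * g - f * derivative g) < 0 := by
        refine lt_of_not_ge fun hcon => ?_
        obtain ⟨z, hzK, hz⟩ :=
          hKpre.intermediate_value hx₀K hx hWcont.continuousOn ⟨h0.le, hcon⟩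
        exact (hKL hzK).2 hz
      exact div_neg_of_neg_of_pos hWx (by positivity)
    · left
      refine strictMonoOn_of_deriv_pos hconv hRcont fun x hx => ?_
      rw [hint] at hx
      rw [(hloc x hx).2.2.deriv]
      have hg := (hloc x hx).1
      have hWx : 0 < aeval x (derivative f * g - f * derivative g) := by
        refine lt_of_not_ge fun hcon => ?_
        obtain ⟨z, hzK, hz⟩ :=
          hKpre.intermediate_value hx hx₀K hWcont.continuousOn ⟨hcon, h0.le⟩
        exact (hKL hzK).2 hz
      positivity
  · -- (3) the shape of the cell
    obtain ⟨p, hpx₀, hpL, hshape⟩ := cellMonotone_component_shape hLo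
      (fun y hy => cellMonotone_lowerBound A B hy.1) hx₀
    refine ⟨p, hpx₀, cellMonotone_end_eq_zero A B f g hKL hpL ?_, ?_⟩
    · rcases hshape with h | ⟨q, hx₀q, -, h⟩
      · rw [hK, h, closure_Ioi]; exact self_mem_Ici
      · rw [hK, h, closure_Ioo (hpx₀.trans hx₀q).ne]
        exact left_mem_Icc.mpr (hpx₀.trans hx₀q).le
    · rcases hshape with h | ⟨q, hx₀q, hqL, h⟩
      · exact Or.inl h
      · refine Or.inr ⟨q, hx₀q, cellMonotone_end_eq_zero A B f g hKL hqL ?_, h⟩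
        rw [hK, h, closure_Ioo (hpx₀.trans hx₀q).ne]
        exact right_mem_Icc.mpr (hpx₀.trans hx₀q).le

end Summit.KontsevichZagierPeriods.IsogenyCertificates.XMapPeriodTransferCells

end
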